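import Summits.CriticalPhenomena.PercolationContinuityZ3.Theorems.FK.InfiniteVolumeDLRFinite
import Summits.CriticalPhenomena.PercolationContinuityZ3.Theorems.FK.InfiniteVolumeGibbs
import Literature.Probability.LatticeModels.RandomClusterFKG
import HarnessLib

/-!
# FK-continuity transplant, FO-06/FO-10 (infinite-volume structure): the free / wired laws of a finite region as
# pattern sums over `E_Λ` — edge transport between `finsetGraph (zdGraph d) Λ` on `↥Λ` and the patterns `η ⊆ E_Λ`

Registered R80 (cell INBOX l.5895, 2026-08-23); registry row FO-10b-g407k; label KCM-C (coordinator fk-4 g175).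
Cell `fk-continuity` (bschramm), FO-10b lineage; support file for the FK-continuity transplant
(`--supports stmt-CriticalPhenomena-4575`); builds on p205010 (kernel theorem, internal audit signed; external expert
review pending). No named facts, no definitions, no sorries, standard axioms. Banked infinite-volume structure; not an
END-STATE dependency of the cell (not consumed by `_r3`); it says nothing about FH / TP_FK or continuity at `p_c`.

* `comap_openGraph_liftEdges`, `clusterCount_eq_card_comap_sup`, `map_edgeFinset_finsetGraph_eq_edgesIn`,
  `image_edgeFinset_finsetGraph_eq_edgesIn`, `sum_powerset_edgesIn_eq_sum_powerset_edgeFinset`,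
  `liftEdges_coe_eq_coe_map`, `liftEdges_coe_eq_coe_image'` — bookkeeping;
* `rcMeasure_finsetGraph_real_preimage_liftEdges_eq`, `rcPartitionFunction_finsetGraph_eq_sum` — for any wired set
  `B ⊆ ↥Λ`: `φ^B_{Λ,p,q}(liftEdges Λ ⁻¹' A) = (∑_{η ⊆ E_Λ, η ∈ A} w_B(η)) / (∑_{η ⊆ E_Λ} w_B(η))` with
  `w_B(η) = p^{|η|}(1-p)^{|E_Λ ∖ η|} q^{#components of (openGraph η).comap val ⊔ wired B}`;
* `regionFreeReal_eq_sum_div` (`B = ∅`), `regionWiredReal_eq_sum_div` (`B = ∂Λ`) — the two region laws of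
  `InfiniteVolumeGibbs.lean` as pattern sums.

## References

* G. Grimmett, *The Random-Cluster Model*, Springer 2006: §1.2 eqs. (1.1)–(1.3), §4.2 (4.11)–(4.12). [Grimmett2006]
-/

noncomputable section

open Finset SimpleGraph

namespace Summit.CriticalPhenomena.PercolationContinuityZ3.Theorems.FK

open Literature.Probability.Percolation Literature.Probability.LatticeModels

variable {d : ℕ}

/-- The open graph of a lifted edge set, pulled back to `↥Λ`, is the open graph of the edge set. [folklore] -/
theorem comap_openGraph_liftEdges (Λ : Finset (Site d)) (ω : BondConfig ↥Λ) :
    (openGraph (liftEdges Λ ω)).comap (Subtype.val : ↥Λ → Site d) = openGraph ω := by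
  ext a b
  simp only [SimpleGraph.comap_adj, openGraph_adj, mem_liftEdges_iff, ne_eq]
  constructor
  · rintro ⟨⟨e, he, hee⟩, hne⟩
    refine ⟨?_, fun h => hne (congrArg Subtype.val h)⟩
    induction e using Sym2.ind with
    | h x y =>
      rw [Sym2.map_mk, Sym2.eq_iff] at hee
      rcases hee with ⟨hx, hy⟩ | ⟨hx, hy⟩
      · rw [Subtype.ext hx, Subtype.ext hy] at he; exact he
      · rw [Subtype.ext hx, Subtype.ext hy] at he; rw [Sym2.eq_swap]; exact he
  · rintro ⟨he, hne⟩
    exact ⟨⟨s(a, b), he, by rw [Sym2.map_mk]⟩, fun h => hne (Subtype.ext h)⟩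


/-- The number of clusters of the finite graph with wired set `B` is the component count of the pulled-back open
graph glued with `wired B`. [cite: Grimmett2006, §1.2 eq. (1.1)] -/
theorem clusterCount_eq_card_comap_sup (Λ : Finset (Site d)) (ω : BondConfig ↥Λ) (B : Set ↥Λ) :
    clusterCount ω B = Nat.card ((openGraph (liftEdges Λ ω)).comap (Subtype.val : ↥Λ → Site d) ⊔ wired B).ConnectedComponent := by
  rw [clusterCount, comap_openGraph_liftEdges]


/-- The edges of the finite graph `(Λ, E_Λ)` on `↥Λ`, pushed to `ℤ^d`, are exactly `E_Λ = edgesIn (zdGraph d) Λ`. [cite: Grimmett2006, §4.2 (E_Λ)] -/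
theorem map_edgeFinset_finsetGraph_eq_edgesIn (Λ : Finset (Site d)) :
    (finsetGraph (zdGraph d) Λ).edgeFinset.map (Function.Embedding.subtype (· ∈ Λ)).sym2Map =
      edgesIn (zdGraph d) Λ := by
  ext e
  rw [Finset.mem_map, mem_edgesIn_iff]
  constructor
  · rintro ⟨e', he', rfl⟩
    induction e' using Sym2.ind with
    | h a b =>
      rw [mem_edgeFinset, SimpleGraph.mem_edgeSet, finsetGraph_adj_iff] at he'
      refine ⟨?_, ?_⟩
      · simpa [Function.Embedding.sym2Map_apply] using he'
      · intro v hv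
        simp only [Function.Embedding.sym2Map_apply, Function.Embedding.coe_subtype, Sym2.map_mk,
          Sym2.mem_iff] at hv
        rcases hv with rfl | rfl
        · exact a.2
        · exact b.2
  · intro h
    induction e using Sym2.ind with
    | h x y =>
      obtain ⟨hadj, hmem⟩ := h
      have hx : x ∈ Λ := hmem x (Sym2.mem_mk_left x y)
      have hy : y ∈ Λ := hmem y (Sym2.mem_mk_right x y)
      refine ⟨s(⟨x, hx⟩, ⟨y, hy⟩), ?_, ?_⟩
      · rw [mem_edgeFinset, SimpleGraph.mem_edgeSet, finsetGraph_adj_iff]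
        exact (SimpleGraph.mem_edgeSet _).1 hadj
      · simp [Function.Embedding.sym2Map_apply]

/-- Lifting an edge finset of `↥Λ` to `ℤ^d` is mapping it along `Sym2.map Subtype.val`. [cite: Grimmett2006, §4.2] -/
theorem liftEdges_coe_eq_coe_map (Λ : Finset (Site d)) (ω : Finset (Sym2 ↥Λ)) :
    liftEdges Λ (↑ω : BondConfig ↥Λ) = ↑(ω.map (Function.Embedding.subtype (· ∈ Λ)).sym2Map) := by
  rw [Finset.coe_map]
  rfl

/-- The same with `image`. [cite: Grimmett2006, §4.2 (E_Λ)] -/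
theorem image_edgeFinset_finsetGraph_eq_edgesIn (Λ : Finset (Site d)) :
    (finsetGraph (zdGraph d) Λ).edgeFinset.image (Sym2.map Subtype.val) = edgesIn (zdGraph d) Λ := by
  classical
  rw [← map_edgeFinset_finsetGraph_eq_edgesIn, Finset.map_eq_image]
  rfl

/-- **Reindexing the patterns**: a sum over the inside patterns `η ⊆ E_Λ` is a sum over the edge subsets of the
finite graph `(Λ, E_Λ)` on `↥Λ`. [cite: Grimmett2006, §4.2] -/
theorem sum_powerset_edgesIn_eq_sum_powerset_edgeFinset {M : Type*} [AddCommMonoid M] (Λ : Finset (Site d))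
    (F : Finset (Sym2 (Site d)) → M) :
    ∑ η ∈ (edgesIn (zdGraph d) Λ).powerset, F η =
      ∑ ω ∈ (finsetGraph (zdGraph d) Λ).edgeFinset.powerset, F (ω.image (Sym2.map Subtype.val)) := by
  classical
  rw [← image_edgeFinset_finsetGraph_eq_edgesIn, Finset.powerset_image, Finset.sum_image]
  intro ω₁ _ ω₂ _ h
  exact (Finset.image_injective (Sym2.map.injective (Subtype.val_injective (p := fun x : Site d => x ∈ Λ)))) h

/-- Lifting an edge finset of `↥Λ` to `ℤ^d` is taking its image along `Sym2.map Subtype.val`. [cite: Grimmett2006, §4.2] -/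
theorem liftEdges_coe_eq_coe_image' (Λ : Finset (Site d)) (ω : Finset (Sym2 ↥Λ)) :
    liftEdges Λ (↑ω : BondConfig ↥Λ) = ↑(ω.image (Sym2.map Subtype.val)) := by
  classical
  rw [Finset.coe_image]
  rfl


/-- **A finite-region random-cluster law as a pattern sum** (`0 ≤ p ≤ 1`, `q > 0`, any wired set `B ⊆ ↥Λ`): for
every event `A` of `ℤ^d`, `φ^B_{Λ,p,q}(liftEdges Λ ⁻¹' A) = (∑_{η ⊆ E_Λ, η ∈ A} w_B(η)) / (∑_{η ⊆ E_Λ} w_B(η))` with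
`w_B(η) = p^{|η|} (1-p)^{|E_Λ ∖ η|} q^{k_B(η)}`, `k_B(η)` = the number of components of the pulled-back open graph of
`η` on `↥Λ` glued with `wired B`. [cite: Grimmett2006, §4.2 (4.11)–(4.12)] -/
theorem rcMeasure_finsetGraph_real_preimage_liftEdges_eq {p q : ℝ} (hp : p ∈ Set.Icc (0 : ℝ) 1) (hq : 0 < q)
    (Λ : Finset (Site d)) (B : Set ↥Λ) (A : Set (BondConfig (Site d))) [DecidablePred (· ∈ A)] :
    (rcMeasure (finsetGraph (zdGraph d) Λ) p q B).real (liftEdges Λ ⁻¹' A) =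
      (∑ η ∈ (edgesIn (zdGraph d) Λ).powerset,
          if (↑η : BondConfig (Site d)) ∈ A then
            p ^ η.card * (1 - p) ^ (edgesIn (zdGraph d) Λ \ η).card *
              q ^ Nat.card ((openGraph (↑η : BondConfig (Site d))).comap (Subtype.val : ↥Λ → Site d) ⊔
                wired B).ConnectedComponent
          else 0) /
        ∑ η ∈ (edgesIn (zdGraph d) Λ).powerset,
          p ^ η.card * (1 - p) ^ (edgesIn (zdGraph d) Λ \ η).card *
            q ^ Nat.card ((openGraph (↑η : BondConfig (Site d))).comap (Subtype.val : ↥Λ → Site d) ⊔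
              wired B).ConnectedComponent := by
  classical
  set G := finsetGraph (zdGraph d) Λ with hG
  have hinj : Function.Injective (Sym2.map (Subtype.val : ↥Λ → Site d)) :=
    Sym2.map.injective Subtype.val_injective
  -- termwise transport of the weight
  have hw : ∀ ω ∈ G.edgeFinset.powerset, rcWeight G p q B ω =
      p ^ (ω.image (Sym2.map Subtype.val)).card *
        (1 - p) ^ (edgesIn (zdGraph d) Λ \ ω.image (Sym2.map Subtype.val)).card *
        q ^ Nat.card ((openGraph (↑(ω.image (Sym2.map Subtype.val)) : BondConfig (Site d))).comap
          (Subtype.val : ↥Λ → Site d) ⊔ wired B).ConnectedComponent := by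
    intro ω hω
    have hωE := Finset.mem_powerset.1 hω
    unfold rcWeight
    rw [Finset.card_image_of_injective _ hinj, ← image_edgeFinset_finsetGraph_eq_edgesIn,
      ← Finset.image_sdiff_of_injOn hinj.injOn hωE, Finset.card_image_of_injective _ hinj,
      clusterCount_eq_card_comap_sup, liftEdges_coe_eq_coe_image']
  have hZ : rcPartitionFunction G p q B =
      ∑ η ∈ (edgesIn (zdGraph d) Λ).powerset, p ^ η.card * (1 - p) ^ (edgesIn (zdGraph d) Λ \ η).card *
        q ^ Nat.card ((openGraph (↑η : BondConfig (Site d))).comap (Subtype.val : ↥Λ → Site d) ⊔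
          wired B).ConnectedComponent := by
    rw [rcPartitionFunction, sum_powerset_edgesIn_eq_sum_powerset_edgeFinset]
    exact Finset.sum_congr rfl hw
  rw [rcMeasure_real_apply G hp hq B, sum_powerset_edgesIn_eq_sum_powerset_edgeFinset, ← hZ, Finset.sum_div]
  refine Finset.sum_congr rfl fun ω hω => ?_
  rw [Set.mem_preimage, liftEdges_coe_eq_coe_image']
  split_ifs with hA
  · rw [hw ω hω]
  · rw [zero_div]

/-- **The free region law as a pattern sum**: `wired ∅`. [cite: Grimmett2006, §4.2 (4.11)–(4.12), ξ = 0] -/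
theorem regionFreeReal_eq_sum_div {p q : ℝ} (hp : p ∈ Set.Icc (0 : ℝ) 1) (hq : 0 < q) (Λ : Finset (Site d))
    (A : Set (BondConfig (Site d))) [DecidablePred (· ∈ A)] :
    regionFreeReal d p q Λ A =
      (∑ η ∈ (edgesIn (zdGraph d) Λ).powerset,
          if (↑η : BondConfig (Site d)) ∈ A then
            p ^ η.card * (1 - p) ^ (edgesIn (zdGraph d) Λ \ η).card *
              q ^ Nat.card ((openGraph (↑η : BondConfig (Site d))).comap (Subtype.val : ↥Λ → Site d) ⊔
                wired (∅ : Set ↥Λ)).ConnectedComponent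
          else 0) /
        ∑ η ∈ (edgesIn (zdGraph d) Λ).powerset,
          p ^ η.card * (1 - p) ^ (edgesIn (zdGraph d) Λ \ η).card *
            q ^ Nat.card ((openGraph (↑η : BondConfig (Site d))).comap (Subtype.val : ↥Λ → Site d) ⊔
              wired (∅ : Set ↥Λ)).ConnectedComponent :=
  rcMeasure_finsetGraph_real_preimage_liftEdges_eq hp hq Λ ∅ A

/-- **The wired region law as a pattern sum**: `wired (∂Λ)`. [cite: Grimmett2006, §4.2 (4.11)–(4.12), ξ = 1] -/
theorem regionWiredReal_eq_sum_div {p q : ℝ} (hp : p ∈ Set.Icc (0 : ℝ) 1) (hq : 0 < q) (Λ : Finset (Site d))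
    (A : Set (BondConfig (Site d))) [DecidablePred (· ∈ A)] :
    regionWiredReal d p q Λ A =
      (∑ η ∈ (edgesIn (zdGraph d) Λ).powerset,
          if (↑η : BondConfig (Site d)) ∈ A then
            p ^ η.card * (1 - p) ^ (edgesIn (zdGraph d) Λ \ η).card *
              q ^ Nat.card ((openGraph (↑η : BondConfig (Site d))).comap (Subtype.val : ↥Λ → Site d) ⊔
                wired (wiredBoundary (zdGraph d) Λ)).ConnectedComponent
          else 0) /
        ∑ η ∈ (edgesIn (zdGraph d) Λ).powerset,
          p ^ η.card * (1 - p) ^ (edgesIn (zdGraph d) Λ \ η).card *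
            q ^ Nat.card ((openGraph (↑η : BondConfig (Site d))).comap (Subtype.val : ↥Λ → Site d) ⊔
              wired (wiredBoundary (zdGraph d) Λ)).ConnectedComponent :=
  rcMeasure_finsetGraph_real_preimage_liftEdges_eq hp hq Λ _ A


/-- The partition function of the finite graph `(Λ, E_Λ)` with wired set `B`, as a pattern sum. [cite: Grimmett2006, §1.2 eq. (1.3)] -/
theorem rcPartitionFunction_finsetGraph_eq_sum {p q : ℝ} (Λ : Finset (Site d)) (B : Set ↥Λ) :
    rcPartitionFunction (finsetGraph (zdGraph d) Λ) p q B =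
      ∑ η ∈ (edgesIn (zdGraph d) Λ).powerset,
        p ^ η.card * (1 - p) ^ (edgesIn (zdGraph d) Λ \ η).card *
          q ^ Nat.card ((openGraph (↑η : BondConfig (Site d))).comap (Subtype.val : ↥Λ → Site d) ⊔
            wired B).ConnectedComponent := by
  classical
  have hinj : Function.Injective (Sym2.map (Subtype.val : ↥Λ → Site d)) :=
    Sym2.map.injective Subtype.val_injective
  rw [rcPartitionFunction, sum_powerset_edgesIn_eq_sum_powerset_edgeFinset]
  refine Finset.sum_congr rfl fun ω hω => ?_
  have hωE := Finset.mem_powerset.1 hω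
  unfold rcWeight
  rw [Finset.card_image_of_injective _ hinj, ← image_edgeFinset_finsetGraph_eq_edgesIn,
    ← Finset.image_sdiff_of_injOn hinj.injOn hωE, Finset.card_image_of_injective _ hinj,
    clusterCount_eq_card_comap_sup, liftEdges_coe_eq_coe_image']

end Summit.CriticalPhenomena.PercolationContinuityZ3.Theorems.FK

end
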